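import Summits.Parity.GeneralizedHardyLittlewood.Theorems.LeeYangFibresCellParityLawP2Defs
import Literature.NumberTheory.Sieve.AsymptoticSieveForPrimesTyz
import Literature.NumberTheory.Sieve.FriedlanderIwaniecPrimesSectorBounds
import HarnessLib

/-!
# Route `LeeYangFibres`, crux `CellParityLaw` (stmt-Parity-14109), line `section-annihilator`:
# tools for the registered stub `stub_fibreInheritance` (fibres of admissible data)

Skeleton v18 (lead c5). Elementary bookkeeping for `FibreInheritance` (vocabulary file
`LeeYangFibresCellParityLawP2Defs`; the stub itself is proved in `LeeYangFibresCellParityLawFibreInheritance`):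

* finite-sum tools (`ω(d) ≤ log d/log 2`, the harmonic bound);
* density facts under `Ω(1, L')`:
  `Σ_{d ≤ x sqfree} g(d) ≤ ∏_{q ≤ x} (1 + g(q)) ≤ ∏_{q ≤ x} (1 − g(q))⁻¹ ≤ (log(x+1)/log 2)(1 + L'/log 2) ≤ K log x`,
  `K = 4(1 + 2|L'|)`, and the junk weight `W = Σ_{d ≤ x sqfree} (1/d + |A₁| g(d)) ≤ (3 + |A₁| K) log x`;
* the fibre identities (reindexing `n = pm`): `(𝒜_p)_{d}(y) = A_{pd}(py)`, `(𝒜_p)(y) = (𝒜_p)_1(y)`, and for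
  `p ∤ d` the remainder `r^{(p)}_d(y) = r_{pd}(py) − g(d) r_p(py)` (`g(pd) = g(p) g(d)`); `A_d(y) ≤ ⌊y⌋/d` for
  weights `≤ 1`;
* the maxima over truncations `h_d = max_{n ≤ ⌊x⌋} |r_d(n)|`: `|r_d(y)| ≤ h_d` for `y ≤ x` and
  `Σ_{d ≤ x^{1-η} sqfree} h_d ≤ R` under `StrongTypeI` (`exists_truncMajorant`);
* the fibre's level `(x/p)^{1 − η log x/log(x/p)} = x^{1-η}/p` and the fibre Type-I bounds
  `R_p = Σ_{d' ≤ x^{1-η}/p, sqfree, p ∤ d'} (h_{pd'} + g(d') h_p) + (x/p²) W ≥ 0`.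

References: J. Friedlander, H. Iwaniec, Ann. Sc. Norm. Sup. Pisa (4) 5 (1978) §4 [FriedlanderIwaniecPisa1978];
E. Bombieri, Rend. Accad. Naz. XL (5) 1/2 (1975/76) §1 [BombieriAsymptoticSieve1976].
-/

noncomputable section

open scoped BigOperators Classical
open Finset Literature.NumberTheory.Sieve

namespace Summit.Parity.GeneralizedHardyLittlewood.Cruxes.CellParityLaw.SectionAnnihilator

namespace FibreInheritanceAux

/-! ## Finite-sum tools -/

/-- `ω`-type bound: the number of primes of a set `P` dividing `d ≠ 0` is at most `log d / log 2`
(`2^{ω(d)} ≤ ∏_{p ∣ d} p ≤ d`). [folklore] -/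
theorem card_filter_dvd_le_log {P : Finset ℕ} (hP : ∀ p ∈ P, p.Prime) {d : ℕ} (hd : d ≠ 0) :
    (((P.filter (· ∣ d)).card : ℕ) : ℝ) ≤ Real.log d / Real.log 2 := by
  have hsub : P.filter (· ∣ d) ⊆ d.primeFactors := fun p hp => by
    obtain ⟨hpP, hpd⟩ := Finset.mem_filter.mp hp
    exact Nat.mem_primeFactors.mpr ⟨hP p hpP, hpd, hd⟩
  have h1 : (P.filter (· ∣ d)).card ≤ d.primeFactors.card := Finset.card_le_card hsub
  have h2 : 2 ^ d.primeFactors.card ≤ d :=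
    calc 2 ^ d.primeFactors.card ≤ ∏ p ∈ d.primeFactors, p :=
          Finset.pow_card_le_prod _ _ 2 fun p hp => (Nat.prime_of_mem_primeFactors hp).two_le
      _ ≤ d := Nat.le_of_dvd (Nat.pos_of_ne_zero hd) (Nat.prod_primeFactors_dvd d)
  rw [le_div_iff₀ (Real.log_pos one_lt_two), ← Real.log_pow]
  refine Real.log_le_log (by positivity) ?_
  calc (2 : ℝ) ^ (P.filter (· ∣ d)).card ≤ (2 : ℝ) ^ d.primeFactors.card :=
        pow_le_pow_right₀ one_le_two h1
    _ ≤ d := by exact_mod_cast h2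

/-- The harmonic bound `Σ_{1 ≤ i ≤ n} 1/i ≤ 1 + log n` (Mathlib's `harmonic_le_one_add_log`). [folklore] -/
theorem sum_Icc_one_div_le_log (n : ℕ) : ∑ i ∈ Finset.Icc 1 n, (1 : ℝ) / i ≤ 1 + Real.log n := by
  have h := harmonic_le_one_add_log n
  rw [harmonic_eq_sum_Icc, Rat.cast_sum] at h
  simpa [one_div] using h

/-- `1 ≤ 2 log x` for `x ≥ 2`. -/
theorem one_le_two_mul_log {x : ℝ} (hx : 2 ≤ x) : 1 ≤ 2 * Real.log x := by
  have h2 := Real.log_two_gt_d9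
  have hlogx : Real.log 2 ≤ Real.log x := Real.log_le_log two_pos hx
  linarith

/-! ## Density facts under `Ω(1, L')` -/

/-- **Squarefree density sums are dominated by the Euler product**: for multiplicative `g` with
`0 ≤ g(p) < 1` on primes, `Σ_{d ≤ N sqfree} g(d) ≤ Σ_{d ∣ P} g(d) = ∏_{p ≤ N} (1 + g(p)) ≤ ∏_{p ≤ N} (1 - g(p))⁻¹`,
`P = ∏_{p ≤ N} p`. [folklore] -/
theorem sum_squarefree_density_le_prod {g : ArithmeticFunction ℝ} (hg : g.IsMultiplicative)
    (h01 : ∀ p : ℕ, p.Prime → 0 ≤ g p ∧ g p < 1) (N : ℕ) :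
    ∑ d ∈ (Finset.Icc 1 N).filter Squarefree, g d ≤
      ∏ p ∈ Nat.primesBelow (N + 1), (1 - g p)⁻¹ := by
  set Q : ℕ := primesProdBelow ((N + 1 : ℕ) : ℝ) with hQ
  have hQsq : Squarefree Q := squarefree_primesProdBelow _
  have hQ0 : Q ≠ 0 := hQsq.ne_zero
  have hQpf : Q.primeFactors = Nat.primesBelow (N + 1) := by
    rw [hQ, primeFactors_primesProdBelow, Nat.ceil_natCast]
  -- squarefree `d ≤ N` divide `Q`
  have hsub : (Finset.Icc 1 N).filter Squarefree ⊆ Q.divisors := by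
    intro d hd
    obtain ⟨hdI, hdsq⟩ := Finset.mem_filter.mp hd
    obtain ⟨-, hdN⟩ := Finset.mem_Icc.mp hdI
    refine Nat.mem_divisors.mpr ⟨?_, hQ0⟩
    rw [← Nat.prod_primeFactors_of_squarefree hdsq, ← Nat.prod_primeFactors_of_squarefree hQsq]
    refine Finset.prod_dvd_prod_of_subset _ _ _ fun p hp => ?_
    rw [hQpf]
    exact Nat.mem_primesBelow.mpr
      ⟨Nat.lt_succ_of_le ((Nat.le_of_mem_primeFactors hp).trans hdN), Nat.prime_of_mem_primeFactors hp⟩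
  calc ∑ d ∈ (Finset.Icc 1 N).filter Squarefree, g d ≤ ∑ d ∈ Q.divisors, g d :=
        Finset.sum_le_sum_of_subset_of_nonneg hsub fun d hd _ =>
          hg.nonneg_of_squarefree (fun p hp => (h01 p hp).1)
            (hQsq.squarefree_of_dvd (Nat.mem_divisors.mp hd).1)
    _ = ∏ p ∈ Q.primeFactors, (1 + g p) := (hg.prodPrimeFactors_one_add_of_squarefree hQsq).symm
    _ ≤ ∏ p ∈ Q.primeFactors, (1 - g p)⁻¹ := by
        refine Finset.prod_le_prod (fun p hp => ?_) fun p hp => ?_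
        · linarith [(h01 p (Nat.prime_of_mem_primeFactors hp)).1]
        · -- `1 + t ≤ (1 - t)⁻¹` for `0 ≤ t < 1`
          obtain ⟨h0, h1⟩ := h01 p (Nat.prime_of_mem_primeFactors hp)
          rw [inv_eq_one_div, le_div_iff₀ (by linarith)]
          nlinarith
    _ = ∏ p ∈ Nat.primesBelow (N + 1), (1 - g p)⁻¹ := by rw [hQpf]

/-- **The Euler product under `Ω(1, L')`**: `∏_{p ≤ N} (1 - g(p))⁻¹ ≤ (log(N+1)/log 2)(1 + L'/log 2)` for `N ≥ 1`
(`HasIwaniecDimension` at `(w, z) = (2, N+1)`). [folklore] -/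
theorem prod_inv_le_of_dimension {g : ArithmeticFunction ℝ} {L' : ℝ} (hdim : HasIwaniecDimension g 1 L')
    {N : ℕ} (hN : 1 ≤ N) :
    ∏ p ∈ Nat.primesBelow (N + 1), (1 - g p)⁻¹ ≤
      Real.log ((N : ℝ) + 1) / Real.log 2 * (1 + L' / Real.log 2) := by
  have hN2 : (2 : ℝ) ≤ (N : ℝ) + 1 := by
    have : (1 : ℝ) ≤ N := by exact_mod_cast hN
    linarith
  have h := hdim.2 2 ((N : ℝ) + 1) le_rfl hN2
  have hceil : ⌈(N : ℝ) + 1⌉₊ = N + 1 := by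
    have : ((N : ℝ) + 1) = ((N + 1 : ℕ) : ℝ) := by push_cast; ring
    rw [this, Nat.ceil_natCast]
  rw [hceil, Real.rpow_one, Finset.filter_true_of_mem] at h
  · exact h
  · intro p hp
    exact_mod_cast (Nat.prime_of_mem_primesBelow hp).two_le

/-- **Squarefree density sum at scale `x ≥ 2`**: `Σ_{d ≤ x sqfree} g(d) ≤ 4 (1 + 2|L'|) log x`. [folklore] -/
theorem sum_squarefree_density_le_log {g : ArithmeticFunction ℝ} {L' : ℝ} (hg : g.IsMultiplicative)
    (hdim : HasIwaniecDimension g 1 L') {x : ℝ} (hx : 2 ≤ x) :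
    ∑ d ∈ (Finset.Icc 1 ⌊x⌋₊).filter Squarefree, g d ≤ 4 * (1 + 2 * |L'|) * Real.log x := by
  have hlog2 : (1 : ℝ) / 2 < Real.log 2 := by
    have := Real.log_two_gt_d9
    linarith
  have hlog2pos : 0 < Real.log 2 := by linarith
  have hx0 : 0 < x := by linarith
  have hlogx : Real.log 2 ≤ Real.log x := Real.log_le_log two_pos hx
  have hlogx0 : 0 < Real.log x := by linarith
  have hN : 1 ≤ ⌊x⌋₊ := Nat.le_floor (by simpa using (show (1 : ℝ) ≤ x by linarith))
  have h1 := sum_squarefree_density_le_prod hg hdim.1 ⌊x⌋₊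
  have h2 := prod_inv_le_of_dimension hdim hN
  -- `log(⌊x⌋ + 1) ≤ log (2x) = log 2 + log x ≤ 2 log x`
  have h3 : Real.log ((⌊x⌋₊ : ℝ) + 1) ≤ 2 * Real.log x := by
    have hfl : (⌊x⌋₊ : ℝ) + 1 ≤ 2 * x := by
      have := Nat.floor_le hx0.le
      linarith
    calc Real.log ((⌊x⌋₊ : ℝ) + 1) ≤ Real.log (2 * x) := Real.log_le_log (by positivity) hfl
      _ = Real.log 2 + Real.log x := Real.log_mul two_ne_zero hx0.ne'
      _ ≤ 2 * Real.log x := by linarith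
  have hL0 : 0 ≤ L' := hdim.nonneg
  have h4 : 1 + L' / Real.log 2 ≤ 1 + 2 * |L'| := by
    rw [abs_of_nonneg hL0]
    have : L' / Real.log 2 ≤ L' / (1 / 2) := div_le_div_of_nonneg_left hL0 (by norm_num) hlog2.le
    linarith
  have h5 : Real.log ((⌊x⌋₊ : ℝ) + 1) / Real.log 2 ≤ 4 * Real.log x := by
    rw [div_le_iff₀ hlog2pos]
    nlinarith
  calc ∑ d ∈ (Finset.Icc 1 ⌊x⌋₊).filter Squarefree, g d
      ≤ Real.log ((⌊x⌋₊ : ℝ) + 1) / Real.log 2 * (1 + L' / Real.log 2) := h1.trans h2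
    _ ≤ 4 * Real.log x * (1 + 2 * |L'|) := by
        refine mul_le_mul h5 h4 ?_ (by positivity)
        have : 0 ≤ L' / Real.log 2 := div_nonneg hL0 hlog2pos.le
        linarith
    _ = 4 * (1 + 2 * |L'|) * Real.log x := by ring

/-- **The junk weight** `W = Σ_{d ≤ x sqfree} (1/d + |A₁| g(d)) ≥ 0`. -/
theorem junkW_nonneg (A₁ : ℝ) (𝒜 : SieveSequence) (x : ℝ) (h0 : ∀ q : ℕ, q.Prime → 0 ≤ 𝒜.density q) :
    0 ≤ ∑ d ∈ (Finset.Icc 1 ⌊x⌋₊).filter Squarefree, (1 / (d : ℝ) + |A₁| * 𝒜.density d) :=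
  Finset.sum_nonneg fun d hd => add_nonneg (by positivity)
    (mul_nonneg (abs_nonneg _) (𝒜.density_mult.nonneg_of_squarefree h0 (Finset.mem_filter.mp hd).2))

/-- `W ≤ (3 + |A₁| K) log x`, `K = 4(1 + 2|L'|)` (harmonic bound + squarefree density sum). -/
theorem junkW_le (A₁ : ℝ) (𝒜 : SieveSequence) {L' x : ℝ} (hdim : HasIwaniecDimension 𝒜.density 1 L')
    (hx : 2 ≤ x) :
    ∑ d ∈ (Finset.Icc 1 ⌊x⌋₊).filter Squarefree, (1 / (d : ℝ) + |A₁| * 𝒜.density d) ≤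
      (3 + |A₁| * (4 * (1 + 2 * |L'|))) * Real.log x := by
  rw [Finset.sum_add_distrib, ← Finset.mul_sum]
  have hx0 : 0 < x := by linarith
  have h1 : ∑ d ∈ (Finset.Icc 1 ⌊x⌋₊).filter Squarefree, 1 / (d : ℝ) ≤ 1 + Real.log x := by
    calc ∑ d ∈ (Finset.Icc 1 ⌊x⌋₊).filter Squarefree, 1 / (d : ℝ)
        ≤ ∑ d ∈ Finset.Icc 1 ⌊x⌋₊, 1 / (d : ℝ) :=
          Finset.sum_le_sum_of_subset_of_nonneg (Finset.filter_subset _ _) fun d _ _ => by positivity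
      _ ≤ 1 + Real.log (⌊x⌋₊ : ℝ) := sum_Icc_one_div_le_log _
      _ ≤ 1 + Real.log x := by
          have hfl : (⌊x⌋₊ : ℝ) ≤ x := Nat.floor_le hx0.le
          have hfl0 : (0 : ℝ) < (⌊x⌋₊ : ℝ) := by
            exact_mod_cast Nat.floor_pos.mpr (by linarith)
          linarith [Real.log_le_log hfl0 hfl]
  have h2 := sum_squarefree_density_le_log 𝒜.density_mult hdim hx
  have hlog := one_le_two_mul_log hx
  have hA : 0 ≤ |A₁| := abs_nonneg _
  have h3 := mul_le_mul_of_nonneg_left h2 hA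
  nlinarith

/-! ## Fibre identities -/

/-- The weights of the fibre. -/
@[simp] theorem fibreSeq_a (𝒜 : SieveSequence) (p q : ℕ) : (fibreSeq 𝒜 p).a q = 𝒜.a (p * q) := rfl

/-- The density of the fibre is the parent's. -/
@[simp] theorem fibreSeq_density (𝒜 : SieveSequence) (p : ℕ) : (fibreSeq 𝒜 p).density = 𝒜.density := rfl

/-- **Reindexing `n = pm`**: `(𝒜_p)_{d}(y) = A_{pd}(py)` for `p ≥ 1`. [folklore] -/
theorem fibreSeq_congrSum (𝒜 : SieveSequence) {p : ℕ} (hp : 0 < p) (d : ℕ) (y : ℝ) :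
    (fibreSeq 𝒜 p).congrSum d y = 𝒜.congrSum (p * d) ((p : ℝ) * y) := by
  unfold SieveSequence.congrSum
  simp only [fibreSeq_a]
  have hp0 : (0 : ℝ) < (p : ℝ) := by exact_mod_cast hp
  refine Finset.sum_nbij' (fun m => p * m) (fun n => n / p) ?_ ?_ ?_ ?_ ?_
  · intro m hm
    simp only [Finset.mem_filter, Finset.mem_Ioc] at hm ⊢
    obtain ⟨⟨hm0, hmy⟩, hdm⟩ := hm
    refine ⟨⟨Nat.mul_pos hp hm0, ?_⟩, Nat.mul_dvd_mul_left p hdm⟩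
    have hy1 : (1 : ℝ) ≤ y := Nat.floor_pos.mp (by omega)
    have hmy' : (m : ℝ) ≤ y := (Nat.le_floor_iff (by linarith)).mp hmy
    refine Nat.le_floor ?_
    push_cast
    exact mul_le_mul_of_nonneg_left hmy' hp0.le
  · intro n hn
    simp only [Finset.mem_filter, Finset.mem_Ioc] at hn ⊢
    obtain ⟨⟨hn0, hny⟩, hdn⟩ := hn
    obtain ⟨k, rfl⟩ : p ∣ n := (dvd_mul_right p d).trans hdn
    rw [Nat.mul_div_cancel_left k hp]
    refine ⟨⟨Nat.pos_of_mul_pos_left hn0, ?_⟩, Nat.dvd_of_mul_dvd_mul_left hp hdn⟩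
    have hy1 : (1 : ℝ) ≤ (p : ℝ) * y := Nat.floor_pos.mp (by omega)
    have hky : ((p * k : ℕ) : ℝ) ≤ (p : ℝ) * y := (Nat.le_floor_iff (by linarith)).mp hny
    push_cast at hky
    have hky' : (k : ℝ) ≤ y := le_of_mul_le_mul_left hky hp0
    have hy0 : 0 ≤ y := by
      by_contra hneg
      push Not at hneg
      have : (p : ℝ) * y < 0 := mul_neg_of_pos_of_neg hp0 hneg
      linarith
    exact (Nat.le_floor_iff hy0).mpr hky'
  · intro m _
    exact Nat.mul_div_cancel_left m hp
  · intro n hn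
    simp only [Finset.mem_filter, Finset.mem_Ioc] at hn
    exact Nat.mul_div_cancel' ((dvd_mul_right p d).trans hn.2)
  · intro m _
    rfl

/-- The fibre's size is its own counting function: `(𝒜_p).size y = (𝒜_p)_1(y)`. -/
theorem fibreSeq_size (𝒜 : SieveSequence) (p : ℕ) (y : ℝ) :
    (fibreSeq 𝒜 p).size y = (fibreSeq 𝒜 p).congrSum 1 y := by
  unfold SieveSequence.congrSum
  rw [Finset.filter_true_of_mem fun m _ => one_dvd m]
  rfl

/-- **The fibre's remainder at a modulus coprime to `p`**:
`r^{(p)}_{d}(y) = r_{pd}(py) − g(d) r_p(py)` (`g(pd) = g(p) g(d)`). [folklore] -/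
theorem fibreSeq_remainder_of_coprime (𝒜 : SieveSequence) {p d : ℕ} (hp : 0 < p) (hpd : p.Coprime d)
    (y : ℝ) :
    (fibreSeq 𝒜 p).remainder d y =
      𝒜.remainder (p * d) ((p : ℝ) * y) - 𝒜.density d * 𝒜.remainder p ((p : ℝ) * y) := by
  have hmul : 𝒜.density (p * d) = 𝒜.density p * 𝒜.density d :=
    𝒜.density_mult.map_mul_of_coprime hpd
  simp only [SieveSequence.remainder]
  rw [fibreSeq_size, fibreSeq_congrSum 𝒜 hp, fibreSeq_congrSum 𝒜 hp, mul_one, hmul, fibreSeq_density]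
  ring

/-- With weights `≤ 1`: `A_d(y) ≤ #{n ≤ ⌊y⌋ : d ∣ n} = ⌊y⌋ / d`. [folklore] -/
theorem congrSum_le_floor_div (𝒜 : SieveSequence) (ha : ∀ q : ℕ, 𝒜.a q ≤ 1) (d : ℕ) (y : ℝ) :
    𝒜.congrSum d y ≤ ((⌊y⌋₊ / d : ℕ) : ℝ) := by
  unfold SieveSequence.congrSum
  calc ∑ n ∈ (Finset.Ioc 0 ⌊y⌋₊).filter (d ∣ ·), 𝒜.a n
      ≤ ∑ n ∈ (Finset.Ioc 0 ⌊y⌋₊).filter (d ∣ ·), (1 : ℝ) := Finset.sum_le_sum fun n _ => ha n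
    _ = ((⌊y⌋₊ / d : ℕ) : ℝ) := by
        rw [Finset.sum_const, nsmul_eq_mul, mul_one, Nat.Ioc_filter_dvd_card_eq_div]

/-! ## The maxima over truncations -/

/-- **Maxima over truncations.** Under the size normalisation and the strong Type-I bound there is a
majorant `h_d ≥ 0` of all truncated remainders `|r_d(y)|`, `y ≤ x`, with `Σ_{d ≤ x^{1-η} sqfree} h_d ≤ R`:
`h_d = max_{0 ≤ n ≤ ⌊x⌋} |r_d(n)|` (the remainder only sees `⌊y⌋`; `StrongTypeI` at a maximising selection
`y_d = n_d ≤ ⌊x⌋ ≤ x`). -/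
theorem exists_truncMajorant (𝒜 : SieveSequence) {x η R : ℝ} (hx : 0 ≤ x)
    (hsize : ∀ t, 𝒜.size t = 𝒜.congrSum 1 t) (hT : StrongTypeI 𝒜 x η R) :
    ∃ h : ℕ → ℝ, (∀ d, 0 ≤ h d) ∧ (∀ (d : ℕ) (y : ℝ), y ≤ x → |𝒜.remainder d y| ≤ h d) ∧
      ∑ d ∈ (Finset.Icc 1 ⌊x ^ (1 - η)⌋₊).filter Squarefree, h d ≤ R := by
  set h : ℕ → ℝ := fun d =>
    (Finset.range (⌊x⌋₊ + 1)).sup' Finset.nonempty_range_add_one fun n : ℕ => |𝒜.remainder d n| with hh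
  refine ⟨h, fun d => ?_, fun d y hy => ?_, ?_⟩
  · exact (abs_nonneg (𝒜.remainder d ((0 : ℕ) : ℝ))).trans
      (Finset.le_sup' (fun n : ℕ => |𝒜.remainder d n|) (Finset.mem_range.mpr (Nat.succ_pos _)))
  · -- `r_d(y) = r_d(⌊y⌋)` and `⌊y⌋ ≤ ⌊x⌋`
    have hfl : 𝒜.remainder d y = 𝒜.remainder d (⌊y⌋₊ : ℝ) := by
      simp only [SieveSequence.remainder, hsize, SieveSequence.congrSum, Nat.floor_natCast]
    rw [hfl]
    have hmem : ⌊y⌋₊ ∈ Finset.range (⌊x⌋₊ + 1) :=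
      Finset.mem_range.mpr (Nat.lt_succ_of_le (Nat.floor_le_floor hy))
    exact Finset.le_sup' (fun n : ℕ => |𝒜.remainder d n|) hmem
  · have hsel : ∀ d : ℕ, ∃ n : ℕ, n ≤ ⌊x⌋₊ ∧ h d = |𝒜.remainder d n| := fun d => by
      obtain ⟨n, hn, he⟩ := Finset.exists_mem_eq_sup' (Finset.nonempty_range_add_one (n := ⌊x⌋₊))
        (fun n : ℕ => |𝒜.remainder d n|)
      exact ⟨n, Nat.lt_succ_iff.mp (Finset.mem_range.mp hn), he⟩
    choose nsel hnle hneq using hsel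
    have hsum := hT (fun d => (nsel d : ℝ)) fun d =>
      (show ((nsel d : ℕ) : ℝ) ≤ (⌊x⌋₊ : ℝ) by exact_mod_cast hnle d).trans (Nat.floor_le hx)
    calc ∑ d ∈ (Finset.Icc 1 ⌊x ^ (1 - η)⌋₊).filter Squarefree, h d
        = ∑ d ∈ (Finset.Icc 1 ⌊x ^ (1 - η)⌋₊).filter Squarefree, |𝒜.remainder d (nsel d)| :=
          Finset.sum_congr rfl fun d _ => hneq d
      _ ≤ R := hsum

/-! ## The fibre's level and the fibre Type-I bounds `R_p` -/

/-- **The fibre's level is the parent's divided by `p`**: `(x/p)^{1 − η log x/log(x/p)} = x^{1-η}/p` for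
`0 < p < x`. -/
theorem fibre_level {x p η : ℝ} (hx : 0 < x) (hp : 0 < p) (hpx : p < x) :
    (x / p) ^ (1 - η * Real.log x / Real.log (x / p)) = x ^ (1 - η) / p := by
  have hxp : 0 < x / p := div_pos hx hp
  have hl : Real.log (x / p) ≠ 0 := (Real.log_pos ((one_lt_div hp).mpr hpx)).ne'
  rw [Real.rpow_def_of_pos hxp, Real.rpow_def_of_pos hx]
  have e : Real.log (x / p) * (1 - η * Real.log x / Real.log (x / p)) =
      Real.log (x / p) - η * Real.log x := by
    field_simp
  have e2 : Real.log x * (1 - η) = Real.log x - η * Real.log x := by ring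
  rw [e, e2, Real.exp_sub, Real.exp_sub, Real.exp_log hxp, Real.exp_log hx]
  ring

/-- `0 ≤ R_p`, `R_p = Σ_{d' ≤ x^{1-η}/p, sqfree, p ∤ d'} (h_{pd'} + g(d') h_p) + (x/p²) W`, for a majorant `h ≥ 0`. -/
theorem fibreBound_nonneg (A₁ : ℝ) (𝒜 : SieveSequence) (x η : ℝ) (p : ℕ) (h : ℕ → ℝ) (hx : 0 ≤ x)
    (hh0 : ∀ d, 0 ≤ h d) (h0 : ∀ q : ℕ, q.Prime → 0 ≤ 𝒜.density q) :
    0 ≤ ∑ d ∈ ((Finset.Icc 1 ⌊x ^ (1 - η) / (p : ℝ)⌋₊).filter Squarefree).filter (fun d => p.Coprime d),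
          (h (p * d) + 𝒜.density d * h p) +
        x / (p : ℝ) ^ 2 * ∑ d ∈ (Finset.Icc 1 ⌊x⌋₊).filter Squarefree, (1 / (d : ℝ) + |A₁| * 𝒜.density d) := by
  refine add_nonneg (Finset.sum_nonneg fun d hd => ?_)
    (mul_nonneg (by positivity) (junkW_nonneg A₁ 𝒜 x h0))
  have hsq : Squarefree d := (Finset.mem_filter.mp (Finset.mem_filter.mp hd).1).2
  exact add_nonneg (hh0 _) (mul_nonneg (𝒜.density_mult.nonneg_of_squarefree h0 hsq) (hh0 _))

end FibreInheritanceAux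

/-- **`stub_fibreRemainder`** (registered sub-goal of the line, carried by this auxiliary file): the remainder
of the fibre `𝒜_p` at a modulus `d` coprime to `p` and truncation `y` is `r_{pd}(py) − g(d) r_p(py)`
(`FibreInheritanceAux.fibreSeq_remainder_of_coprime`). -/
theorem stub_fibreRemainder : ∀ (𝒜 : SieveSequence) (p d : ℕ), 0 < p → p.Coprime d → ∀ y : ℝ, (fibreSeq 𝒜 p).remainder d y = 𝒜.remainder (p * d) ((p : ℝ) * y) - 𝒜.density d * 𝒜.remainder p ((p : ℝ) * y) :=
  fun 𝒜 _ _ hp hpd y => FibreInheritanceAux.fibreSeq_remainder_of_coprime 𝒜 hp hpd y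

end Summit.Parity.GeneralizedHardyLittlewood.Cruxes.CellParityLaw.SectionAnnihilator

end
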